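import Literature.NumberTheory.LFunctions.TaoLogElliottProp26PerPrime
import HarnessLib

/-!
# Tao's log-averaged Elliott theorem: Proposition 2.6 (averaging the lower bound over `𝒫_H`)

Part of the proof DAG below the named fact `Literature.NumberTheory.LFunctions.Tao2016_theorem23_core` (Tao, Forum Math. Pi 4
(2016) e8, the proof of Theorem 2.3).  **Proposition 2.6** converts the lower bound (2.14),
`|X| ≫ ε` for `X = 𝔼 1_{𝐧 ≡ b (a)} g₁(𝐧) g₂(𝐧+h)`, into the lower bound (2.15) on the "bilinear"
expression along the random graph,
`|𝔼 ∑_{p ∈ 𝒫_H} ∑_{j : j, j+ph ∈ [1,H]} c_p 1_{a𝐧+j ≡ pb (ap)} g₁(a𝐧+j) g₂(a𝐧+j+ph)| ≫ ε H/log H`.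
This file PROVES it, following the printed proof, from the per-prime step (2.16)
(`Literature.NumberTheory.LFunctions.Tao2016.norm_logAvg_Zpj_sub_le`, `TaoLogElliottProp26PerPrime.lean`) and the tree's
quantitative Lemma 2.5 (`TaoLogElliottLogAvg.lean`), with all `o_{A→∞}(1)` made explicit as
multiples of `1/S`, `S = ∑_{x/ω<n≤x} 1/n`:

* `Usum` — `U_p(n) = c_p ∑_{j=1}^H 1_{n+j ≡ pb (ap)} g₁(n+j) g₂(n+j+ph)`;
  `norm_logAvg_Usum_sub_le` — (2.17): `𝔼 U_p = H X / p + O(H err_p)`;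
* `Qp` — `Q(s) = 𝔼 U_p(𝐧) 1_{𝐧 ≡ s (a)}` ((2.18)); `norm_Qp_succ_sub_le` — `Q(s+1) = Q(s) + O(1/p)`
  (translation by `1`, the two boundary terms each of probability `1/p + o(1)`);
  `norm_Qp_sub_Qp_zero_le`, `norm_Qp_zero_sub_le` — `Q(0) = H X/(ap) + O(a/p)` ((2.19) and after);
* `norm_logAvg_Tsum_mul_sub_le` — summing over `𝒫` and undoing `1_{a ∣ 𝐧}` by Lemma 2.5
  (`q = a`): `𝔼 T(a𝐧) = H X ∑_p 1/p + O(a² ∑_p 1/p) + O(1/S)`;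
* `norm_logAvg_restrict_sub_le` — discarding the `j` with `j + ph ∉ [1, H]` costs `|h| #𝒫 + O(1/S)`;
* `prop26` — **Proposition 2.6, explicit form**:
  `|𝔼 F| ≥ (H |X| - 2a²) ∑_{p∈𝒫} 1/p - |h| #𝒫 - (6 a² H + |h| p_max) #𝒫 (4H + 2 log H + 12)/S`
  for `𝒫` a set of primes in `(a, H]`.  With `|X| ≫ ε/a`, `∑_{p∈𝒫_H} 1/p ≍ 1/log H`
  (`card_primesP_ge`/`card_primesP_le`), `#𝒫_H ≪ ε²H/log H`, `p ≤ ε²H` and `S ≥ log A - 1`, this is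
  `≫ ε H/log H` once `H ≥ H₋(a, h, ε)` and `A` is large, as printed.

## References
* T. Tao, Forum Math. Pi 4 (2016), e8; arXiv:1509.05422, §2, Proposition 2.6 and its proof
  ((2.15)–(2.19) and the four displays following (2.19)).

## Design choices
* As in `TaoLogElliottProp26PerPrime.lean`: `gᵢ` completely multiplicative and unimodular on `ℕ₊`
  and `1`-bounded at `0`; integer arguments through `Int.toNat`; `|h| + 1 ≤ x/ω`.
* All Lemma 2.5 errors are dominated by `L/S`, `L = 4H + 2 log H + 12`, using `p ≤ H`, `a ≤ H`.
-/

open Finset Real Complex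

namespace Literature.NumberTheory.LFunctions

namespace Tao2016

/-! ### More generalities on `𝔼` -/

/-- `𝔼 0 = 0`. [folklore] -/
theorem logAvg_zero (x ω : ℝ) : logAvg (fun _ => (0 : ℂ)) x ω = 0 := by
  unfold logAvg wsum; simp

/-- `𝔼` commutes with finite sums. [folklore] -/
theorem logAvg_finset_sum {ι : Type*} (J : Finset ι) (f : ι → ℕ → ℂ) (x ω : ℝ) :
    logAvg (fun n => ∑ j ∈ J, f j n) x ω = ∑ j ∈ J, logAvg (f j) x ω := by
  classical
  induction J using Finset.induction_on with
  | empty => simp [logAvg_zero]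
  | insert i J hi ih =>
    rw [sum_insert hi, ← ih, ← logAvg_add]
    exact logAvg_congr fun n _ => by rw [sum_insert hi]

/-- **Monotonicity of `𝔼` for an indicator majorant**: if `|Z(n)| ≤ 1_{P(n)}` then
`|𝔼 Z| ≤ 𝔼 1_P` (the right side being a nonnegative real). [folklore] -/
theorem norm_logAvg_le_of_indicator {Z : ℕ → ℂ} {P : ℕ → Prop} [DecidablePred P] {x ω : ℝ}
    (hS : 0 < logWeightSum x ω) (hZ : ∀ n, ‖Z n‖ ≤ if P n then 1 else 0) :
    ‖logAvg Z x ω‖ ≤ ‖logAvg (fun n => if P n then (1 : ℂ) else 0) x ω‖ := by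
  unfold logAvg wsum
  rw [norm_div, norm_div, Complex.norm_real, Real.norm_of_nonneg hS.le]
  refine div_le_div_of_nonneg_right ?_ hS.le
  have hreal : ∑ n ∈ Ioc ⌊x / ω⌋₊ ⌊x⌋₊, (if P n then (1 : ℂ) else 0) / (n : ℂ) =
      ((∑ n ∈ Ioc ⌊x / ω⌋₊ ⌊x⌋₊, (if P n then (1 : ℝ) else 0) / (n : ℝ) : ℝ) : ℂ) := by
    push_cast
    refine sum_congr rfl fun n _ => ?_
    split_ifs <;> simp
  rw [hreal, Complex.norm_real, Real.norm_of_nonneg (sum_nonneg fun n _ => by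
    split_ifs <;> positivity)]
  refine (norm_sum_le _ _).trans (sum_le_sum fun n _ => ?_)
  rw [norm_div, Complex.norm_natCast]
  refine div_le_div_of_nonneg_right ((hZ n).trans (le_of_eq ?_)) (Nat.cast_nonneg _)
  split_ifs <;> simp

/-- **The probability of a residue class modulo `p`** (Lemma 2.5 with `X = 1`):
`0 ≤ 𝔼 1_{𝐧 % p = r} ≤ 1/p + (8 + 2 log p)/S` for `r < p`. [cite: TaoFMP2016, Lemma 2.5] -/
theorem norm_logAvg_indicator_mod_le {p r : ℕ} (hp : 0 < p) (hr : r < p) {x ω : ℝ}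
    (hS : 0 < logWeightSum x ω) :
    ‖logAvg (fun n => if n % p = r then (1 : ℂ) else 0) x ω‖ ≤
      1 / p + (8 + 2 * Real.log p) / logWeightSum x ω := by
  have h := norm_logAvg_filter_mod_sub_le (X := fun _ => (1 : ℂ)) (fun _ => by simp) hp hr hS
    (x := x) (ω := ω)
  have h1 : logAvg (fun n : ℕ => (1 : ℂ)) x ω = 1 := by
    unfold logAvg wsum logWeightSum
    have hS' : ((∑ n ∈ Ioc ⌊x / ω⌋₊ ⌊x⌋₊, (n : ℝ)⁻¹ : ℝ) : ℂ) ≠ 0 := by exact_mod_cast hS.ne'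
    rw [div_eq_one_iff_eq hS']
    push_cast
    exact sum_congr rfl fun n _ => by rw [one_div]
  rw [show (fun n => (1 : ℂ)) = (fun n => (fun _ => (1 : ℂ)) (p * n + r)) from rfl] at h1
  rw [h1, mul_one] at h
  have hp' : ‖(1 : ℂ) / (p : ℂ)‖ = 1 / p := by
    rw [norm_div, norm_one, Complex.norm_natCast]
  calc ‖logAvg (fun n => if n % p = r then (1 : ℂ) else 0) x ω‖
      ≤ ‖(1 : ℂ) / (p : ℂ)‖ + ‖logAvg (fun n => if n % p = r then (1 : ℂ) else 0) x ω - 1 / (p : ℂ)‖ := by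
        have := norm_add_le ((1 : ℂ) / (p : ℂ)) (logAvg (fun n => if n % p = r then (1 : ℂ) else 0) x ω - 1 / (p : ℂ))
        rwa [add_sub_cancel] at this
    _ ≤ 1 / p + (8 + 2 * Real.log p) / logWeightSum x ω := by rw [hp']; exact add_le_add le_rfl h

/-- A divisibility `p ∣ n + c` (`c ∈ ℤ`) is a residue condition `n % p = r`, `r = (-c) mod p`.
[folklore] -/
theorem dvd_add_iff_mod_eq {p : ℕ} (hp : 0 < p) (c : ℤ) :
    ∃ r : ℕ, r < p ∧ ∀ n : ℕ, ((p : ℤ) ∣ (n : ℤ) + c ↔ n % p = r) := by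
  have hpZ : (p : ℤ) ≠ 0 := by exact_mod_cast hp.ne'
  refine ⟨((-c) % p).toNat, ?_, fun n => ?_⟩
  · have h1 : (-c) % p < p := Int.emod_lt_of_pos _ (by exact_mod_cast hp)
    have h2 : 0 ≤ (-c) % p := Int.emod_nonneg _ hpZ
    zify; rw [Int.toNat_of_nonneg h2]; exact h1
  · have hr0 : 0 ≤ (-c) % p := Int.emod_nonneg _ hpZ
    have step : (n : ℤ) ≡ -c [ZMOD p] ↔ n % p = ((-c) % p).toNat := by
      constructor
      · intro hmod
        have h1 : ((n % p : ℕ) : ℤ) = (-c) % p := by rw [Int.natCast_mod]; exact hmod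
        have h2 := congrArg Int.toNat h1
        rwa [Int.toNat_natCast] at h2
      · intro hmod
        show (n : ℤ) % p = (-c) % p
        rw [← Int.natCast_mod, hmod, Int.toNat_of_nonneg hr0]
    rw [← step, Int.modEq_iff_dvd]
    constructor
    · intro hd; have : -c - (n : ℤ) = -((n : ℤ) + c) := by ring
      rw [this]; exact (dvd_neg).2 hd
    · intro hd; have : (n : ℤ) + c = -(-c - (n : ℤ)) := by ring
      rw [this]; exact (dvd_neg).2 hd

/-- **Expectations supported on `p ∣ 𝐧 + c` are `O(1/p)`**: if `|Z(n)| ≤ 1_{p ∣ n + c}` then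
`|𝔼 Z| ≤ 1/p + (8 + 2 log p)/S`. [cite: TaoFMP2016, Lemma 2.5] -/
theorem norm_logAvg_le_of_dvd {Z : ℕ → ℂ} {p : ℕ} (hp : 0 < p) (c : ℤ) {x ω : ℝ}
    (hS : 0 < logWeightSum x ω)
    (hZ : ∀ n, ‖Z n‖ ≤ if (p : ℤ) ∣ (n : ℤ) + c then 1 else 0) :
    ‖logAvg Z x ω‖ ≤ 1 / p + (8 + 2 * Real.log p) / logWeightSum x ω := by
  obtain ⟨r, hr, hiff⟩ := dvd_add_iff_mod_eq hp c
  have hZ' : ∀ n, ‖Z n‖ ≤ if n % p = r then 1 else 0 := fun n => by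
    have hn := hZ n
    by_cases h1 : (p : ℤ) ∣ (n : ℤ) + c
    · rw [if_pos h1] at hn; rw [if_pos ((hiff n).1 h1)]; exact hn
    · rw [if_neg h1] at hn; rw [if_neg (fun h2 => h1 ((hiff n).2 h2))]; exact hn
  exact (norm_logAvg_le_of_indicator hS hZ').trans (norm_logAvg_indicator_mod_le hp hr hS)

/-! ### `U_p` and display (2.17) -/

/-- `U_p(n) = ∑_{j=1}^H Z_{p,j}(n) = c_p ∑_{j=1}^H 1_{n+j ≡ pb (ap)} g₁(n+j) g₂(n+j+ph)`
(the integrand of (2.17)). [cite: TaoFMP2016, (2.17)] -/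
noncomputable def Usum (a : ℕ) (b h : ℤ) (g₁ g₂ : ℕ → ℂ) (p H : ℕ) : ℕ → ℂ := fun n =>
  ∑ j ∈ Icc 1 H, Zpj a b h g₁ g₂ p (j : ℤ) n

/-- `|Z_{p,j}(n)| ≤ 1_{p ∣ n + j}` (and in particular `≤ 1`). [folklore] -/
theorem norm_Zpj_le_indicator {a : ℕ} {b h : ℤ} {g₁ g₂ : ℕ → ℂ} (hb₁ : ∀ n, ‖g₁ n‖ ≤ 1)
    (hb₂ : ∀ n, ‖g₂ n‖ ≤ 1) (p : ℕ) (j : ℤ) (n : ℕ) :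
    ‖Zpj a b h g₁ g₂ p j n‖ ≤ if (p : ℤ) ∣ (n : ℤ) + j then 1 else 0 := by
  unfold Zpj
  by_cases hd : ((a * p : ℕ) : ℤ) ∣ (n : ℤ) + j - p * b
  · rw [if_pos hd]
    have hpd : (p : ℤ) ∣ (n : ℤ) + j := by
      have hap : (p : ℤ) ∣ ((a * p : ℕ) : ℤ) := Dvd.intro_left (a : ℤ) (by push_cast; ring)
      have h1 : (p : ℤ) ∣ (n : ℤ) + j - p * b := hap.trans hd
      have : (n : ℤ) + j = ((n : ℤ) + j - p * b) + p * b := by ring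
      rw [this]; exact dvd_add h1 (Dvd.intro _ rfl)
    rw [if_pos hpd, norm_mul, norm_mul]
    exact mul_le_one₀ (mul_le_one₀ (norm_cCoeff_le hb₁ hb₂ p) (norm_nonneg _) (hb₁ _))
      (norm_nonneg _) (hb₂ _)
  · rw [if_neg hd, norm_zero]
    split_ifs <;> norm_num

/-- `|Z_{p,j}(n)| ≤ 1`. [folklore] -/
theorem norm_Zpj_le {a : ℕ} {b h : ℤ} {g₁ g₂ : ℕ → ℂ} (hb₁ : ∀ n, ‖g₁ n‖ ≤ 1)
    (hb₂ : ∀ n, ‖g₂ n‖ ≤ 1) (p : ℕ) (j : ℤ) (n : ℕ) : ‖Zpj a b h g₁ g₂ p j n‖ ≤ 1 := by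
  refine (norm_Zpj_le_indicator hb₁ hb₂ p j n).trans ?_
  by_cases hd : (p : ℤ) ∣ (n : ℤ) + j
  · simp [hd]
  · simp [hd]

/-- `|U_p(n)| ≤ H`. [folklore] -/
theorem norm_Usum_le {a : ℕ} {b h : ℤ} {g₁ g₂ : ℕ → ℂ} (hb₁ : ∀ n, ‖g₁ n‖ ≤ 1)
    (hb₂ : ∀ n, ‖g₂ n‖ ≤ 1) (p H n : ℕ) : ‖Usum a b h g₁ g₂ p H n‖ ≤ H := by
  unfold Usum
  refine (norm_sum_le _ _).trans ?_
  calc ∑ j ∈ Icc 1 H, ‖Zpj a b h g₁ g₂ p (j : ℤ) n‖ ≤ ∑ j ∈ Icc 1 H, (1 : ℝ) :=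
        sum_le_sum fun j _ => norm_Zpj_le hb₁ hb₂ p j n
    _ = H := by simp

/-- **Tao 2016, display (2.17)**: summing (2.16) over `j = 1, …, H`,
`|𝔼 U_p - (H/p) X| ≤ H ((8 + 2 log p)/S + 4(H+1)/(pS))`. [cite: TaoFMP2016, (2.17)] -/
theorem norm_logAvg_Usum_sub_le {g₁ g₂ : ℕ → ℂ}
    (hcm₁ : ∀ m n : ℕ, 1 ≤ m → 1 ≤ n → g₁ (m * n) = g₁ m * g₁ n)
    (hcm₂ : ∀ m n : ℕ, 1 ≤ m → 1 ≤ n → g₂ (m * n) = g₂ m * g₂ n)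
    (hS₁ : ∀ n : ℕ, 1 ≤ n → ‖g₁ n‖ = 1) (hS₂ : ∀ n : ℕ, 1 ≤ n → ‖g₂ n‖ = 1)
    (hb₁ : ∀ n, ‖g₁ n‖ ≤ 1) (hb₂ : ∀ n, ‖g₂ n‖ ≤ 1)
    {a p : ℕ} (hp : p.Prime) (hpa : ¬p ∣ a) (H : ℕ) (b h : ℤ) {x ω : ℝ}
    (hS : 0 < logWeightSum x ω) (hrange : (h.natAbs : ℝ) + 1 ≤ x / ω) :
    ‖logAvg (Usum a b h g₁ g₂ p H) x ω - (H : ℂ) / (p : ℂ) * logAvg (corrInd a b h g₁ g₂) x ω‖ ≤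
      H * ((8 + 2 * Real.log p) / logWeightSum x ω +
        4 * ((H : ℝ) + 1) / (p * logWeightSum x ω)) := by
  have hsum : logAvg (Usum a b h g₁ g₂ p H) x ω =
      ∑ j ∈ Icc 1 H, logAvg (Zpj a b h g₁ g₂ p (j : ℤ)) x ω :=
    logAvg_finset_sum _ _ _ _
  have hX : (H : ℂ) / (p : ℂ) * logAvg (corrInd a b h g₁ g₂) x ω =
      ∑ j ∈ Icc 1 H, 1 / (p : ℂ) * logAvg (corrInd a b h g₁ g₂) x ω := by
    rw [sum_const, Nat.card_Icc, nsmul_eq_mul, Nat.add_sub_cancel]; ring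
  rw [hsum, hX, ← sum_sub_distrib]
  refine (norm_sum_le _ _).trans ?_
  calc ∑ j ∈ Icc 1 H, ‖logAvg (Zpj a b h g₁ g₂ p (j : ℤ)) x ω - 1 / (p : ℂ) * logAvg (corrInd a b h g₁ g₂) x ω‖
      ≤ ∑ j ∈ Icc 1 H, ((8 + 2 * Real.log p) / logWeightSum x ω +
          4 * ((H : ℝ) + 1) / (p * logWeightSum x ω)) :=
        sum_le_sum fun j hj => norm_logAvg_Zpj_sub_le hcm₁ hcm₂ hS₁ hS₂ hb₁ hb₂ hp hpa
          (by exact_mod_cast (mem_Icc.1 hj).1) (by exact_mod_cast (mem_Icc.1 hj).2) b h hS hrange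
    _ = _ := by
        rw [sum_const, Nat.card_Icc, nsmul_eq_mul, Nat.add_sub_cancel]

/-! ### `Q(s)` and its near-constancy in `s` -/

/-- `Q(s) = 𝔼 U_p(𝐧) 1_{𝐧 ≡ s (a)}` (Tao 2016, (2.18)). [cite: TaoFMP2016, (2.18)] -/
noncomputable def Qp (a : ℕ) (b h : ℤ) (g₁ g₂ : ℕ → ℂ) (p H : ℕ) (x ω : ℝ) (s : ℕ) : ℂ :=
  logAvg (fun n => if n % a = s then Usum a b h g₁ g₂ p H n else 0) x ω

/-- Shifting the summation: `Z_{p,j}(n+1) = Z_{p,j+1}(n)`. [folklore] -/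
theorem Zpj_succ (a : ℕ) (b h : ℤ) (g₁ g₂ : ℕ → ℂ) (p : ℕ) (j : ℤ) (n : ℕ) :
    Zpj a b h g₁ g₂ p j (n + 1) = Zpj a b h g₁ g₂ p (j + 1) n := by
  unfold Zpj
  have e : ((n + 1 : ℕ) : ℤ) + j = (n : ℤ) + (j + 1) := by push_cast; ring
  simp only [e]

/-- `∑_{j=1}^{H} f(j+1) = ∑_{j=1}^{H} f(j) + f(H+1) - f(1)`. [folklore] -/
theorem sum_Icc_succ_eq (f : ℕ → ℂ) (H : ℕ) :
    ∑ j ∈ Icc 1 H, f (j + 1) = ∑ j ∈ Icc 1 H, f j + f (H + 1) - f 1 := by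
  induction H with
  | zero => simp
  | succ H ih =>
    rw [Finset.sum_Icc_succ_top (by omega), Finset.sum_Icc_succ_top (by omega), ih]
    ring

/-- `U_p(n+1) = U_p(n) + Z_{p,H+1}(n) - Z_{p,1}(n)`. [cite: TaoFMP2016, §2 (proof of Prop. 2.6, "the difference … is zero with probability 1 - O(1/p)")] -/
theorem Usum_succ (a : ℕ) (b h : ℤ) (g₁ g₂ : ℕ → ℂ) (p H n : ℕ) :
    Usum a b h g₁ g₂ p H (n + 1) =
      Usum a b h g₁ g₂ p H n + Zpj a b h g₁ g₂ p ((H : ℤ) + 1) n - Zpj a b h g₁ g₂ p 1 n := by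
  unfold Usum
  simp_rw [Zpj_succ]
  have := sum_Icc_succ_eq (fun j => Zpj a b h g₁ g₂ p (j : ℤ) n) H
  push_cast at this
  exact this

/-- `(n+1) % a = (s+1) % a ↔ n % a = s` for `s < a`. [folklore] -/
theorem succ_mod_eq_iff {a s : ℕ} (hs : s < a) (n : ℕ) : (n + 1) % a = (s + 1) % a ↔ n % a = s := by
  have : n % a = s ↔ n % a = s % a := by rw [Nat.mod_eq_of_lt hs]
  rw [this]
  change n + 1 ≡ s + 1 [MOD a] ↔ n ≡ s [MOD a]
  exact ⟨Nat.ModEq.add_right_cancel' 1, Nat.ModEq.add_right 1⟩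

/-- **`Q(s+1) = Q(s) + O(1/p)`** (Tao 2016, proof of Prop. 2.6: translation by `1` via Lemma 2.5,
then "the difference between `∑_{j=2}^{H+1}` and `∑_{j=1}^{H}` … is zero with probability
`1 - O(1/p)`"): for `s < a`,
`|Q((s+1) mod a) - Q(s)| ≤ 4H/S + 2 (1/p + (8 + 2 log p)/S)`.
[cite: TaoFMP2016, Proposition 2.6 (proof, the display Q(s+1) = Q(s) + O(1/p))] -/
theorem norm_Qp_succ_sub_le {g₁ g₂ : ℕ → ℂ} (hb₁ : ∀ n, ‖g₁ n‖ ≤ 1) (hb₂ : ∀ n, ‖g₂ n‖ ≤ 1)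
    {a p : ℕ} (hp : 0 < p) (H : ℕ) (hH : 1 ≤ H) (b h : ℤ) {x ω : ℝ} (hS : 0 < logWeightSum x ω)
    {s : ℕ} (hs : s < a) :
    ‖Qp a b h g₁ g₂ p H x ω ((s + 1) % a) - Qp a b h g₁ g₂ p H x ω s‖ ≤
      4 * H / logWeightSum x ω + 2 * (1 / p + (8 + 2 * Real.log p) / logWeightSum x ω) := by
  have hH0 : (0 : ℝ) < H := by exact_mod_cast hH
  set U := Usum a b h g₁ g₂ p H with hU
  -- the `1`-bounded variable `Y(n) = 1_{n % a = (s+1)%a} U(n) / H`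
  set Y : ℕ → ℂ := fun n => (if n % a = (s + 1) % a then U n else 0) / (H : ℂ) with hY
  have hYb : ∀ n, ‖Y n‖ ≤ 1 := fun n => by
    simp only [hY]
    rw [norm_div, Complex.norm_natCast, div_le_one hH0]
    split_ifs
    · exact norm_Usum_le hb₁ hb₂ p H n
    · simp
  -- translation by `1`
  have hT := norm_logAvg_shift_up_sub_le hYb 1 hS (x := x) (ω := ω)
  -- `Y(n+1) = (1_{n%a=s} U(n) + 1_{n%a=s} (Z_{H+1}(n) - Z_1(n))) / H`
  have hY1 : (fun n => Y (n + 1)) = fun n =>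
      ((if n % a = s then U n else 0) +
        (if n % a = s then Zpj a b h g₁ g₂ p ((H : ℤ) + 1) n - Zpj a b h g₁ g₂ p 1 n else 0)) / (H : ℂ) := by
    funext n
    simp only [hY]
    by_cases h1 : n % a = s
    · rw [if_pos ((succ_mod_eq_iff hs n).2 h1), if_pos h1, if_pos h1, hU, Usum_succ]; ring
    · rw [if_neg (fun h2 => h1 ((succ_mod_eq_iff hs n).1 h2)), if_neg h1, if_neg h1]; simp
  rw [hY1] at hT
  -- expectations
  have eQs1 : logAvg Y x ω = Qp a b h g₁ g₂ p H x ω ((s + 1) % a) / (H : ℂ) := by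
    simp only [hY, Qp, hU, div_eq_mul_inv]
    rw [show (fun n => (if n % a = (s + 1) % a then Usum a b h g₁ g₂ p H n else 0) * ((H : ℂ))⁻¹) =
      fun n => ((H : ℂ))⁻¹ * (if n % a = (s + 1) % a then Usum a b h g₁ g₂ p H n else 0) by
      funext n; ring]
    rw [logAvg_const_mul]; ring
  set B : ℕ → ℂ := fun n =>
    if n % a = s then Zpj a b h g₁ g₂ p ((H : ℤ) + 1) n - Zpj a b h g₁ g₂ p 1 n else 0 with hB
  have eY1 : logAvg (fun n => ((if n % a = s then U n else 0) + B n) / (H : ℂ)) x ω =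
      (Qp a b h g₁ g₂ p H x ω s + logAvg B x ω) / (H : ℂ) := by
    simp only [div_eq_mul_inv]
    rw [show (fun n => ((if n % a = s then U n else 0) + B n) * ((H : ℂ))⁻¹) =
      fun n => ((H : ℂ))⁻¹ * ((if n % a = s then U n else 0) + B n) by funext n; ring]
    rw [logAvg_const_mul, logAvg_add]
    simp only [Qp, hU]
    ring
  rw [eQs1, eY1] at hT
  -- the boundary terms: `|𝔼 B| ≤ 2 (1/p + err)`
  have hBle : ‖logAvg B x ω‖ ≤ 2 * (1 / p + (8 + 2 * Real.log p) / logWeightSum x ω) := by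
    have hB' : B = fun n => (if n % a = s then Zpj a b h g₁ g₂ p ((H : ℤ) + 1) n else 0) -
        (if n % a = s then Zpj a b h g₁ g₂ p 1 n else 0) := by
      funext n; simp only [hB]; split_ifs <;> simp
    rw [hB', logAvg_sub]
    refine (norm_sub_le _ _).trans ?_
    have key : ∀ j : ℤ, ‖logAvg (fun n => if n % a = s then Zpj a b h g₁ g₂ p j n else 0) x ω‖ ≤
        1 / p + (8 + 2 * Real.log p) / logWeightSum x ω := by
      intro j
      refine norm_logAvg_le_of_dvd hp j hS fun n => ?_
      split_ifs with h1 h2 h2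
      · exact (norm_Zpj_le_indicator hb₁ hb₂ p j n).trans (by rw [if_pos h2])
      · have := norm_Zpj_le_indicator (a := a) (b := b) (h := h) hb₁ hb₂ p j n
        rw [if_neg h2] at this; exact this
      · simp
      · simp
    linarith [key ((H : ℤ) + 1), key 1]
  -- conclude: multiply the translation estimate by `H`
  have hHC : ‖(H : ℂ)‖ = H := Complex.norm_natCast H
  have key2 : ‖Qp a b h g₁ g₂ p H x ω ((s + 1) % a) - (Qp a b h g₁ g₂ p H x ω s + logAvg B x ω)‖ ≤
      4 * H / logWeightSum x ω := by
    have e : Qp a b h g₁ g₂ p H x ω ((s + 1) % a) - (Qp a b h g₁ g₂ p H x ω s + logAvg B x ω) =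
        (H : ℂ) * ((Qp a b h g₁ g₂ p H x ω s + logAvg B x ω) / (H : ℂ) -
          Qp a b h g₁ g₂ p H x ω ((s + 1) % a) / (H : ℂ)) * (-1) := by
      have hH' : (H : ℂ) ≠ 0 := by exact_mod_cast hH0.ne'
      field_simp
      ring
    rw [e, norm_mul, norm_mul, hHC, norm_neg, norm_one, mul_one]
    calc (H : ℝ) * ‖(Qp a b h g₁ g₂ p H x ω s + logAvg B x ω) / (H : ℂ) -
          Qp a b h g₁ g₂ p H x ω ((s + 1) % a) / (H : ℂ)‖ ≤ H * (4 * (1 : ℕ) / logWeightSum x ω) :=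
          mul_le_mul_of_nonneg_left hT (Nat.cast_nonneg _)
      _ = 4 * H / logWeightSum x ω := by push_cast; ring
  calc ‖Qp a b h g₁ g₂ p H x ω ((s + 1) % a) - Qp a b h g₁ g₂ p H x ω s‖
      ≤ ‖Qp a b h g₁ g₂ p H x ω ((s + 1) % a) - (Qp a b h g₁ g₂ p H x ω s + logAvg B x ω)‖ +
          ‖logAvg B x ω‖ := by
        have := norm_add_le (Qp a b h g₁ g₂ p H x ω ((s + 1) % a) - (Qp a b h g₁ g₂ p H x ω s + logAvg B x ω)) (logAvg B x ω)
        rwa [show Qp a b h g₁ g₂ p H x ω ((s + 1) % a) - (Qp a b h g₁ g₂ p H x ω s + logAvg B x ω) + logAvg B x ω =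
          Qp a b h g₁ g₂ p H x ω ((s + 1) % a) - Qp a b h g₁ g₂ p H x ω s by ring] at this
    _ ≤ _ := add_le_add key2 hBle

/-- **`Q(s) = Q(0) + O(s/p)`** for `s < a` (iterate `norm_Qp_succ_sub_le`).
[cite: TaoFMP2016, Proposition 2.6 (proof, "Thus Q fluctuates by at most O(a/p)")] -/
theorem norm_Qp_sub_Qp_zero_le {g₁ g₂ : ℕ → ℂ} (hb₁ : ∀ n, ‖g₁ n‖ ≤ 1) (hb₂ : ∀ n, ‖g₂ n‖ ≤ 1)
    {a p : ℕ} (hp : 0 < p) (H : ℕ) (hH : 1 ≤ H) (b h : ℤ) {x ω : ℝ} (hS : 0 < logWeightSum x ω)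
    {s : ℕ} (hs : s < a) :
    ‖Qp a b h g₁ g₂ p H x ω s - Qp a b h g₁ g₂ p H x ω 0‖ ≤
      s * (4 * H / logWeightSum x ω + 2 * (1 / p + (8 + 2 * Real.log p) / logWeightSum x ω)) := by
  induction s with
  | zero => simp
  | succ s ih =>
    have hs' : s < a := Nat.lt_of_succ_lt hs
    have hstep := norm_Qp_succ_sub_le hb₁ hb₂ hp H hH b h hS hs' (a := a) (x := x) (ω := ω)
    rw [Nat.mod_eq_of_lt hs] at hstep
    have := ih hs'
    calc ‖Qp a b h g₁ g₂ p H x ω (s + 1) - Qp a b h g₁ g₂ p H x ω 0‖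
        ≤ ‖Qp a b h g₁ g₂ p H x ω (s + 1) - Qp a b h g₁ g₂ p H x ω s‖ +
            ‖Qp a b h g₁ g₂ p H x ω s - Qp a b h g₁ g₂ p H x ω 0‖ := norm_sub_le_norm_sub_add_norm_sub _ _ _
      _ ≤ _ := by push_cast; linarith

/-- `∑_{s < a} Q(s) = 𝔼 U_p` (the residues partition the range; Tao 2016, (2.19)).
[cite: TaoFMP2016, (2.19)] -/
theorem sum_Qp_eq {a : ℕ} (ha : 0 < a) (b h : ℤ) (g₁ g₂ : ℕ → ℂ) (p H : ℕ) (x ω : ℝ) :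
    ∑ s ∈ range a, Qp a b h g₁ g₂ p H x ω s = logAvg (Usum a b h g₁ g₂ p H) x ω := by
  unfold Qp
  rw [← logAvg_finset_sum]
  refine logAvg_congr fun n _ => ?_
  rw [sum_ite_eq (range a) (n % a) (fun _ => Usum a b h g₁ g₂ p H n)]
  simp [mem_range.2 (Nat.mod_lt n ha)]

/-- **`Q(0) = H X / (ap) + O(a/p)`** (Tao 2016, the display after (2.19)): precisely
`|Q(0) - (H/(ap)) X| ≤ ((a-1)/2) Δ_p + (H/a) err_p` with
`Δ_p = 4H/S + 2(1/p + (8 + 2 log p)/S)` and `err_p = (8 + 2 log p)/S + 4(H+1)/(pS)`.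
[cite: TaoFMP2016, Proposition 2.6 (proof, display after (2.19))] -/
theorem norm_Qp_zero_sub_le {g₁ g₂ : ℕ → ℂ}
    (hcm₁ : ∀ m n : ℕ, 1 ≤ m → 1 ≤ n → g₁ (m * n) = g₁ m * g₁ n)
    (hcm₂ : ∀ m n : ℕ, 1 ≤ m → 1 ≤ n → g₂ (m * n) = g₂ m * g₂ n)
    (hS₁ : ∀ n : ℕ, 1 ≤ n → ‖g₁ n‖ = 1) (hS₂ : ∀ n : ℕ, 1 ≤ n → ‖g₂ n‖ = 1)
    (hb₁ : ∀ n, ‖g₁ n‖ ≤ 1) (hb₂ : ∀ n, ‖g₂ n‖ ≤ 1)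
    {a p : ℕ} (ha : 0 < a) (hp : p.Prime) (hpa : ¬p ∣ a) (H : ℕ) (hH : 1 ≤ H) (b h : ℤ)
    {x ω : ℝ} (hS : 0 < logWeightSum x ω) (hrange : (h.natAbs : ℝ) + 1 ≤ x / ω) :
    ‖Qp a b h g₁ g₂ p H x ω 0 - (H : ℂ) / ((a : ℂ) * p) * logAvg (corrInd a b h g₁ g₂) x ω‖ ≤
      ((a : ℝ) - 1) / 2 * (4 * H / logWeightSum x ω + 2 * (1 / p + (8 + 2 * Real.log p) / logWeightSum x ω)) +
        H / a * ((8 + 2 * Real.log p) / logWeightSum x ω + 4 * ((H : ℝ) + 1) / (p * logWeightSum x ω)) := by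
  have hp0 : 0 < p := hp.pos
  set Q := Qp a b h g₁ g₂ p H x ω with hQ
  set Δ : ℝ := 4 * H / logWeightSum x ω + 2 * (1 / p + (8 + 2 * Real.log p) / logWeightSum x ω) with hΔ
  set E : ℂ := logAvg (Usum a b h g₁ g₂ p H) x ω with hE
  have haR : (0 : ℝ) < a := by exact_mod_cast ha
  have haC : (a : ℂ) ≠ 0 := by exact_mod_cast ha.ne'
  -- `|a Q(0) - ∑_s Q(s)| ≤ ∑_s s Δ = a(a-1)/2 Δ`
  have h1 : ‖(a : ℂ) * Q 0 - E‖ ≤ (a : ℝ) * ((a : ℝ) - 1) / 2 * Δ := by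
    rw [hE, ← sum_Qp_eq ha b h g₁ g₂ p H x ω, ← hQ]
    have e : (a : ℂ) * Q 0 - ∑ s ∈ range a, Q s = ∑ s ∈ range a, (Q 0 - Q s) := by
      rw [sum_sub_distrib, sum_const, card_range, nsmul_eq_mul]
    rw [e]
    refine (norm_sum_le _ _).trans ?_
    calc ∑ s ∈ range a, ‖Q 0 - Q s‖ ≤ ∑ s ∈ range a, (s : ℝ) * Δ := by
          refine sum_le_sum fun s hs => ?_
          rw [norm_sub_rev]
          exact norm_Qp_sub_Qp_zero_le hb₁ hb₂ hp0 H hH b h hS (mem_range.1 hs)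
      _ = (∑ s ∈ range a, (s : ℝ)) * Δ := by rw [sum_mul]
      _ = (a : ℝ) * ((a : ℝ) - 1) / 2 * Δ := by
          congr 1
          have := Finset.sum_range_id_mul_two a
          have h2 : ((∑ i ∈ range a, i : ℕ) : ℝ) * 2 = (a : ℝ) * ((a : ℝ) - 1) := by
            have e1 : ((a * (a - 1) : ℕ) : ℝ) = (a : ℝ) * ((a : ℝ) - 1) := by
              push_cast [Nat.cast_sub ha]; ring
            rw [← e1]; exact_mod_cast Finset.sum_range_id_mul_two a
          push_cast at h2 ⊢
          linarith
  -- `|E - (H/p) X| ≤ H err_p`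
  have h2 := norm_logAvg_Usum_sub_le hcm₁ hcm₂ hS₁ hS₂ hb₁ hb₂ hp hpa H b h hS hrange (a := a) (x := x) (ω := ω)
  rw [← hE] at h2
  -- divide by `a`
  have e3 : Q 0 - (H : ℂ) / ((a : ℂ) * p) * logAvg (corrInd a b h g₁ g₂) x ω =
      (1 / (a : ℂ)) * (((a : ℂ) * Q 0 - E) + (E - (H : ℂ) / (p : ℂ) * logAvg (corrInd a b h g₁ g₂) x ω)) := by
    field_simp
    ring
  rw [e3, norm_mul, norm_div, norm_one, Complex.norm_natCast]
  calc 1 / (a : ℝ) * ‖((a : ℂ) * Q 0 - E) + (E - (H : ℂ) / (p : ℂ) * logAvg (corrInd a b h g₁ g₂) x ω)‖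
      ≤ 1 / (a : ℝ) * ((a : ℝ) * ((a : ℝ) - 1) / 2 * Δ +
          H * ((8 + 2 * Real.log p) / logWeightSum x ω + 4 * ((H : ℝ) + 1) / (p * logWeightSum x ω))) := by
        refine mul_le_mul_of_nonneg_left ((norm_add_le _ _).trans (add_le_add h1 h2)) (by positivity)
    _ = _ := by
        field_simp

/-! ### Summation over `𝒫` and the passage to `a𝐧` -/

/-- `T(n) = ∑_{p ∈ 𝒫} U_p(n)` (the integrand summed over the primes, all `j ∈ [1, H]`).
[cite: TaoFMP2016, Proposition 2.6 (proof, the sum over 𝒫_H)] -/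
noncomputable def Tsum (a : ℕ) (b h : ℤ) (g₁ g₂ : ℕ → ℂ) (Pr : Finset ℕ) (H : ℕ) : ℕ → ℂ := fun n =>
  ∑ p ∈ Pr, Usum a b h g₁ g₂ p H n

/-- `|T(n)| ≤ #𝒫 · H`. [folklore] -/
theorem norm_Tsum_le {a : ℕ} {b h : ℤ} {g₁ g₂ : ℕ → ℂ} (hb₁ : ∀ n, ‖g₁ n‖ ≤ 1)
    (hb₂ : ∀ n, ‖g₂ n‖ ≤ 1) (Pr : Finset ℕ) (H n : ℕ) :
    ‖Tsum a b h g₁ g₂ Pr H n‖ ≤ Pr.card * H := by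
  unfold Tsum
  refine (norm_sum_le _ _).trans ?_
  calc ∑ p ∈ Pr, ‖Usum a b h g₁ g₂ p H n‖ ≤ ∑ p ∈ Pr, (H : ℝ) := sum_le_sum fun p _ => norm_Usum_le hb₁ hb₂ p H n
    _ = Pr.card * H := by rw [sum_const, nsmul_eq_mul]

/-- `∑_{p ∈ 𝒫} Q_p(0) = 𝔼 T(𝐧) 1_{a ∣ 𝐧}`. [folklore] -/
theorem sum_Qp_zero_eq {a : ℕ} (b h : ℤ) (g₁ g₂ : ℕ → ℂ) (Pr : Finset ℕ) (H : ℕ) (x ω : ℝ) :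
    ∑ p ∈ Pr, Qp a b h g₁ g₂ p H x ω 0 =
      logAvg (fun n => if n % a = 0 then Tsum a b h g₁ g₂ Pr H n else 0) x ω := by
  unfold Qp Tsum
  rw [← logAvg_finset_sum]
  refine logAvg_congr fun n _ => ?_
  split_ifs <;> simp

/-- **`𝔼 T(a𝐧) = H X ∑_p 1/p + (errors)`** (Tao 2016, the two displays after (2.19) and the
application of Lemma 2.5 with `q = a`): for a nonempty finite set `𝒫` of primes not dividing `a`,
`|𝔼 T(a𝐧) - H X ∑_{p∈𝒫} 1/p| ≤ a ∑_p (((a-1)/2) Δ_p + (H/a) err_p) + a #𝒫 H (8 + 2 log a)/S`.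
[cite: TaoFMP2016, Proposition 2.6 (proof, displays after (2.19))] -/
theorem norm_logAvg_Tsum_mul_sub_le {g₁ g₂ : ℕ → ℂ}
    (hcm₁ : ∀ m n : ℕ, 1 ≤ m → 1 ≤ n → g₁ (m * n) = g₁ m * g₁ n)
    (hcm₂ : ∀ m n : ℕ, 1 ≤ m → 1 ≤ n → g₂ (m * n) = g₂ m * g₂ n)
    (hS₁ : ∀ n : ℕ, 1 ≤ n → ‖g₁ n‖ = 1) (hS₂ : ∀ n : ℕ, 1 ≤ n → ‖g₂ n‖ = 1)
    (hb₁ : ∀ n, ‖g₁ n‖ ≤ 1) (hb₂ : ∀ n, ‖g₂ n‖ ≤ 1)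
    {a : ℕ} (ha : 0 < a) {Pr : Finset ℕ} (hPr : ∀ p ∈ Pr, p.Prime ∧ ¬p ∣ a) (hne : Pr.Nonempty)
    (H : ℕ) (hH : 1 ≤ H) (b h : ℤ) {x ω : ℝ} (hS : 0 < logWeightSum x ω)
    (hrange : (h.natAbs : ℝ) + 1 ≤ x / ω) :
    ‖logAvg (fun n => Tsum a b h g₁ g₂ Pr H (a * n)) x ω -
        (H : ℂ) * (∑ p ∈ Pr, 1 / (p : ℂ)) * logAvg (corrInd a b h g₁ g₂) x ω‖ ≤
      a * ∑ p ∈ Pr, (((a : ℝ) - 1) / 2 * (4 * H / logWeightSum x ω + 2 * (1 / p + (8 + 2 * Real.log p) / logWeightSum x ω)) +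
          H / a * ((8 + 2 * Real.log p) / logWeightSum x ω + 4 * ((H : ℝ) + 1) / (p * logWeightSum x ω))) +
        a * (Pr.card * H) * ((8 + 2 * Real.log a) / logWeightSum x ω) := by
  have haR : (0 : ℝ) < a := by exact_mod_cast ha
  have haC : (a : ℂ) ≠ 0 := by exact_mod_cast ha.ne'
  have hH0 : (0 : ℝ) < H := by exact_mod_cast hH
  have hM0 : (0 : ℝ) < Pr.card * H := by
    have : (0 : ℝ) < Pr.card := by exact_mod_cast hne.card_pos
    positivity
  set M : ℝ := Pr.card * H with hM
  set T := Tsum a b h g₁ g₂ Pr H with hT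
  set X₀ := logAvg (corrInd a b h g₁ g₂) x ω with hX₀
  -- Lemma 2.5 with `q = a`, `r = 0`, for `T/M`
  set Y : ℕ → ℂ := fun n => T n / (M : ℂ) with hY
  have hYb : ∀ n, ‖Y n‖ ≤ 1 := fun n => by
    simp only [hY]; rw [norm_div, Complex.norm_real, Real.norm_of_nonneg hM0.le, div_le_one hM0]
    exact norm_Tsum_le hb₁ hb₂ Pr H n
  have h25 := norm_logAvg_filter_mod_sub_le hYb ha ha hS (x := x) (ω := ω)
  simp only [add_zero] at h25
  -- rescale by `M`: `|𝔼 1_{a∣n} T - (1/a) 𝔼 T(a n)| ≤ M (8 + 2 log a)/S`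
  have hMC : (M : ℂ) ≠ 0 := by exact_mod_cast hM0.ne'
  have e1 : logAvg (fun n => if n % a = 0 then Y n else 0) x ω =
      (1 / (M : ℂ)) * logAvg (fun n => if n % a = 0 then T n else 0) x ω := by
    rw [← logAvg_const_mul]
    refine logAvg_congr fun n _ => ?_
    simp only [hY]; split_ifs <;> [skip; simp]; field_simp
  have e2 : logAvg (fun n => Y (a * n)) x ω = (1 / (M : ℂ)) * logAvg (fun n => T (a * n)) x ω := by
    rw [← logAvg_const_mul]
    refine logAvg_congr fun n _ => ?_
    simp only [hY]; field_simp
  rw [e1, e2] at h25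
  have h25' : ‖logAvg (fun n => if n % a = 0 then T n else 0) x ω -
      (1 / (a : ℂ)) * logAvg (fun n => T (a * n)) x ω‖ ≤ M * ((8 + 2 * Real.log a) / logWeightSum x ω) := by
    have e : logAvg (fun n => if n % a = 0 then T n else 0) x ω - (1 / (a : ℂ)) * logAvg (fun n => T (a * n)) x ω =
        (M : ℂ) * ((1 / (M : ℂ)) * logAvg (fun n => if n % a = 0 then T n else 0) x ω -
          (1 / (a : ℂ)) * ((1 / (M : ℂ)) * logAvg (fun n => T (a * n)) x ω)) := by
      field_simp
    rw [e, norm_mul, Complex.norm_real, Real.norm_of_nonneg hM0.le]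
    exact mul_le_mul_of_nonneg_left h25 hM0.le
  -- the per-prime estimates summed over `Pr`
  have hQ : ‖∑ p ∈ Pr, Qp a b h g₁ g₂ p H x ω 0 - (H : ℂ) / (a : ℂ) * (∑ p ∈ Pr, 1 / (p : ℂ)) * X₀‖ ≤
      ∑ p ∈ Pr, (((a : ℝ) - 1) / 2 * (4 * H / logWeightSum x ω + 2 * (1 / p + (8 + 2 * Real.log p) / logWeightSum x ω)) +
          H / a * ((8 + 2 * Real.log p) / logWeightSum x ω + 4 * ((H : ℝ) + 1) / (p * logWeightSum x ω))) := by
    have e : (H : ℂ) / (a : ℂ) * (∑ p ∈ Pr, 1 / (p : ℂ)) * X₀ = ∑ p ∈ Pr, (H : ℂ) / ((a : ℂ) * p) * X₀ := by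
      rw [mul_sum, sum_mul]
      refine sum_congr rfl fun p hp => ?_
      have hp0 : (p : ℂ) ≠ 0 := by exact_mod_cast (hPr p hp).1.ne_zero
      field_simp
    rw [e, ← sum_sub_distrib]
    refine (norm_sum_le _ _).trans (sum_le_sum fun p hp => ?_)
    exact norm_Qp_zero_sub_le hcm₁ hcm₂ hS₁ hS₂ hb₁ hb₂ ha (hPr p hp).1 (hPr p hp).2 H hH b h hS hrange
  rw [sum_Qp_zero_eq] at hQ
  -- combine: `𝔼 T(a n) = a · 𝔼 1_{a|n} T + a · (error of Lemma 2.5)`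
  have e3 : logAvg (fun n => T (a * n)) x ω - (H : ℂ) * (∑ p ∈ Pr, 1 / (p : ℂ)) * X₀ =
      (a : ℂ) * ((logAvg (fun n => if n % a = 0 then T n else 0) x ω - (H : ℂ) / (a : ℂ) * (∑ p ∈ Pr, 1 / (p : ℂ)) * X₀) -
        (logAvg (fun n => if n % a = 0 then T n else 0) x ω - (1 / (a : ℂ)) * logAvg (fun n => T (a * n)) x ω)) := by
    field_simp
    ring
  rw [e3, norm_mul, Complex.norm_natCast]
  calc (a : ℝ) * ‖(logAvg (fun n => if n % a = 0 then T n else 0) x ω - (H : ℂ) / (a : ℂ) * (∑ p ∈ Pr, 1 / (p : ℂ)) * X₀) -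
        (logAvg (fun n => if n % a = 0 then T n else 0) x ω - (1 / (a : ℂ)) * logAvg (fun n => T (a * n)) x ω)‖
      ≤ (a : ℝ) * (∑ p ∈ Pr, (((a : ℝ) - 1) / 2 * (4 * H / logWeightSum x ω + 2 * (1 / p + (8 + 2 * Real.log p) / logWeightSum x ω)) +
          H / a * ((8 + 2 * Real.log p) / logWeightSum x ω + 4 * ((H : ℝ) + 1) / (p * logWeightSum x ω))) +
          M * ((8 + 2 * Real.log a) / logWeightSum x ω)) :=
        mul_le_mul_of_nonneg_left ((norm_sub_le _ _).trans (add_le_add hQ h25')) haR.le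
    _ = _ := by rw [hM]; ring

/-! ### Restricting to `j + ph ∈ [1, H]` -/

/-- The final integrand of (2.15): `F(n) = ∑_{p ∈ 𝒫} ∑_{j ∈ [1,H], j+ph ∈ [1,H]} Z_{p,j}(n)`; at
`n = a𝐧` the constraint `1_{a𝐧 + j ≡ pb (ap)}` inside `Z_{p,j}` is `1_{p ∣ a𝐧 + j} 1_{a ∣ j - pb}`, so
this is the expression inside the expectation in (2.15). [cite: TaoFMP2016, (2.15)] -/
noncomputable def Trest (a : ℕ) (b h : ℤ) (g₁ g₂ : ℕ → ℂ) (Pr : Finset ℕ) (H : ℕ) : ℕ → ℂ := fun n =>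
  ∑ p ∈ Pr, ∑ j ∈ (Icc 1 H).filter (fun j : ℕ => 1 ≤ (j : ℤ) + p * h ∧ (j : ℤ) + p * h ≤ H),
    Zpj a b h g₁ g₂ p (j : ℤ) n

/-- For `p` coprime to `a`, the condition `p ∣ a n + j` is `p ∣ n + c` for a suitable integer `c`.
[folklore] -/
theorem exists_dvd_mul_add_iff {a p : ℕ} (hap : Nat.Coprime a p) (j : ℤ) :
    ∃ c : ℤ, ∀ n : ℤ, ((p : ℤ) ∣ a * n + j ↔ (p : ℤ) ∣ n + c) := by
  obtain ⟨u, v, huv⟩ := (Nat.Coprime.isCoprime hap : IsCoprime (a : ℤ) (p : ℤ))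
  refine ⟨u * j, fun n => ⟨fun hd => ?_, fun hd => ?_⟩⟩
  · have e : n + u * j = u * (a * n + j) + n * (v * p) := by
      have : n = n * (u * a + v * p) := by rw [huv, mul_one]
      linear_combination this
    rw [e]; exact dvd_add (hd.mul_left _) (Dvd.intro_left (n * v) (by ring))
  · have e : (a : ℤ) * n + j = a * (n + u * j) + j * (v * p) := by
      have : j = j * (u * a + v * p) := by rw [huv, mul_one]
      linear_combination this
    rw [e]; exact dvd_add (hd.mul_left _) (Dvd.intro_left (j * v) (by ring))

/-- Each discarded term has expectation `O(1/p)`: `|𝔼 Z_{p,j}(a𝐧)| ≤ 1/p + (8 + 2 log p)/S`.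
[cite: TaoFMP2016, Proposition 2.6 (proof, last paragraph)] -/
theorem norm_logAvg_Zpj_mul_le {g₁ g₂ : ℕ → ℂ} (hb₁ : ∀ n, ‖g₁ n‖ ≤ 1) (hb₂ : ∀ n, ‖g₂ n‖ ≤ 1)
    {a p : ℕ} (hp : p.Prime) (hpa : ¬p ∣ a) (b h : ℤ) (j : ℤ) {x ω : ℝ} (hS : 0 < logWeightSum x ω) :
    ‖logAvg (fun n => Zpj a b h g₁ g₂ p j (a * n)) x ω‖ ≤ 1 / p + (8 + 2 * Real.log p) / logWeightSum x ω := by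
  have hap : Nat.Coprime a p := (Nat.Coprime.symm ((Nat.Prime.coprime_iff_not_dvd hp).2 hpa))
  obtain ⟨c, hc⟩ := exists_dvd_mul_add_iff hap j
  refine norm_logAvg_le_of_dvd hp.pos c hS fun n => ?_
  refine (norm_Zpj_le_indicator hb₁ hb₂ p j (a * n)).trans ?_
  have hiff : (p : ℤ) ∣ ((a * n : ℕ) : ℤ) + j ↔ (p : ℤ) ∣ (n : ℤ) + c := by
    have := hc n; push_cast at this ⊢; exact this
  by_cases hd : (p : ℤ) ∣ (n : ℤ) + c
  · rw [if_pos (hiff.2 hd), if_pos hd]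
  · rw [if_neg (fun h' => hd (hiff.1 h')), if_neg hd]

/-- At most `2 p |h|` values of `j ∈ [1, H]` have `j + ph ∉ [1, H]`. [folklore] -/
theorem card_bad_le (H p : ℕ) (h : ℤ) :
    ((Icc 1 H).filter (fun j : ℕ => ¬(1 ≤ (j : ℤ) + p * h ∧ (j : ℤ) + p * h ≤ H))).card ≤
      2 * (p * h.natAbs) := by
  set k : ℕ := p * h.natAbs with hk
  have hsub : (Icc 1 H).filter (fun j : ℕ => ¬(1 ≤ (j : ℤ) + p * h ∧ (j : ℤ) + p * h ≤ H)) ⊆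
      Ioc (H - k) H ∪ Icc 1 k := by
    intro j hj
    rw [mem_filter, mem_Icc] at hj
    obtain ⟨⟨hj1, hjH⟩, hbad⟩ := hj
    rw [mem_union, mem_Ioc, mem_Icc]
    have hkZ : ((k : ℕ) : ℤ) = p * |h| := by rw [hk]; push_cast; rfl
    rcases le_or_gt 0 h with hh | hh
    · -- `h ≥ 0`: then `j + ph ≥ 1`, so `j + ph > H`, i.e. `j > H - k`
      left
      have h1 : ¬((j : ℤ) + p * h ≤ H) := fun hle => hbad ⟨by nlinarith, hle⟩
      push Not at h1
      have h2 : (p : ℤ) * h = k := by rw [hkZ, abs_of_nonneg hh]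
      rw [h2] at h1
      refine ⟨?_, hjH⟩
      zify at h1 ⊢
      have : ((H - k : ℕ) : ℤ) ≤ (H : ℤ) - k ∨ ((H - k : ℕ) : ℤ) = 0 := by omega
      omega
    · -- `h < 0`: then `j + ph ≤ H`, so `j + ph < 1`, i.e. `j ≤ k`
      right
      have h1 : ¬(1 ≤ (j : ℤ) + p * h) := fun hle => hbad ⟨hle, by nlinarith⟩
      push Not at h1
      have h2 : (p : ℤ) * h = -k := by rw [hkZ, abs_of_neg hh]; ring
      rw [h2] at h1
      refine ⟨hj1, ?_⟩
      zify; linarith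
  calc ((Icc 1 H).filter (fun j : ℕ => ¬(1 ≤ (j : ℤ) + p * h ∧ (j : ℤ) + p * h ≤ H))).card
      ≤ (Ioc (H - k) H ∪ Icc 1 k).card := card_le_card hsub
    _ ≤ (Ioc (H - k) H).card + (Icc 1 k).card := card_union_le _ _
    _ ≤ k + k := by
        rw [Nat.card_Ioc, Nat.card_Icc]
        omega
    _ = 2 * k := by ring

/-- **Discarding the `j` with `j + ph ∉ [1, H]`** (Tao 2016, last paragraph of the proof of
Prop. 2.6: "The contribution of these values of `j` can be easily estimated to be
`O(∑_{p∈𝒫_H} |h| ε² H / p)`"): `|𝔼 T(a𝐧) - 𝔼 F(a𝐧)| ≤ ∑_{p ∈ 𝒫} 2p|h| (1/p + (8 + 2 log p)/S)`.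
[cite: TaoFMP2016, Proposition 2.6 (proof, last paragraph)] -/
theorem norm_logAvg_restrict_sub_le {g₁ g₂ : ℕ → ℂ} (hb₁ : ∀ n, ‖g₁ n‖ ≤ 1) (hb₂ : ∀ n, ‖g₂ n‖ ≤ 1)
    {a : ℕ} {Pr : Finset ℕ} (hPr : ∀ p ∈ Pr, p.Prime ∧ ¬p ∣ a) (H : ℕ) (b h : ℤ) {x ω : ℝ}
    (hS : 0 < logWeightSum x ω) :
    ‖logAvg (fun n => Tsum a b h g₁ g₂ Pr H (a * n)) x ω - logAvg (fun n => Trest a b h g₁ g₂ Pr H (a * n)) x ω‖ ≤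
      ∑ p ∈ Pr, 2 * (p * h.natAbs) * (1 / p + (8 + 2 * Real.log p) / logWeightSum x ω) := by
  set good : ℕ → ℕ → Prop := fun p j => 1 ≤ (j : ℤ) + p * h ∧ (j : ℤ) + p * h ≤ H with hgood
  have hdiff : (fun n => Tsum a b h g₁ g₂ Pr H (a * n)) = fun n => Trest a b h g₁ g₂ Pr H (a * n) +
      ∑ p ∈ Pr, ∑ j ∈ (Icc 1 H).filter (fun j => ¬good p j), Zpj a b h g₁ g₂ p (j : ℤ) (a * n) := by
    funext n
    simp only [Tsum, Trest, Usum, hgood, ← sum_add_distrib]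
    refine sum_congr rfl fun p _ => ?_
    exact (sum_filter_add_sum_filter_not (Icc 1 H) (fun j => 1 ≤ (j : ℤ) + p * h ∧ (j : ℤ) + p * h ≤ H) _).symm
  rw [hdiff, logAvg_add, add_sub_cancel_left, logAvg_finset_sum]
  refine (norm_sum_le _ _).trans (sum_le_sum fun p hp => ?_)
  rw [logAvg_finset_sum]
  refine (norm_sum_le _ _).trans ?_
  calc ∑ j ∈ (Icc 1 H).filter (fun j => ¬good p j), ‖logAvg (fun n => Zpj a b h g₁ g₂ p (j : ℤ) (a * n)) x ω‖
      ≤ ∑ j ∈ (Icc 1 H).filter (fun j => ¬good p j), (1 / p + (8 + 2 * Real.log p) / logWeightSum x ω) :=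
        sum_le_sum fun j _ => norm_logAvg_Zpj_mul_le hb₁ hb₂ (hPr p hp).1 (hPr p hp).2 b h j hS
    _ = ((Icc 1 H).filter (fun j => ¬good p j)).card * (1 / p + (8 + 2 * Real.log p) / logWeightSum x ω) := by
        rw [sum_const, nsmul_eq_mul]
    _ ≤ 2 * (p * h.natAbs) * (1 / p + (8 + 2 * Real.log p) / logWeightSum x ω) := by
        refine mul_le_mul_of_nonneg_right ?_ (by positivity)
        exact_mod_cast card_bad_le H p h

/-! ### Proposition 2.6 -/

/-- **Tao 2016, Proposition 2.6, explicit form.**  Let `g₁, g₂ : ℕ → ℂ` be completely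
multiplicative and unimodular on the positive integers (`1`-bounded at `0`), `a ≥ 1`, `b, h ∈ ℤ`,
`H ≥ 16`, `a ≤ H`, and let `𝒫` be a nonempty finite set of primes `p ≤ H` not dividing `a` (in the
paper `𝒫 = 𝒫_H`, the primes in `[ε²H/2, ε²H]`, `a ≪ 1/ε ≪ H`).  On Tao's logarithmic probability
space (`|h| + 1 ≤ x/ω`, `S = ∑_{x/ω<n≤x} 1/n > 0`), with `X = 𝔼 1_{𝐧 ≡ b (a)} g₁(𝐧) g₂(𝐧+h)` and
`F(n) = ∑_{p∈𝒫} ∑_{j ∈ [1,H], j+ph ∈ [1,H]} c_p 1_{n+j ≡ pb (ap)} g₁(n+j) g₂(n+j+ph)`: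

`|𝔼 F(a𝐧)| ≥ H |X| ∑_{p∈𝒫} 1/p - a² ∑_{p∈𝒫} 1/p - 2|h| #𝒫 - (a² + 2aH + 2|h|H) #𝒫 (4H + 2 log H + 12)/S`.

With (2.14) `|X| ≫ ε` (through Lemma 2.5), `∑_{p∈𝒫_H} 1/p ≫ 1/log H` ("by the prime number
theorem", `Literature.NumberTheory.LFunctions.Tao2016.card_primesP_ge`), `#𝒫_H ≪ ε²H/log H` and `S ≥ log A - 1`, this is the
printed `|𝔼 F(a𝐧)| ≫ ε H/log H` for `H ≥ H₋` and `A` large. [cite: TaoFMP2016, Proposition 2.6] -/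
theorem prop26 {g₁ g₂ : ℕ → ℂ}
    (hcm₁ : ∀ m n : ℕ, 1 ≤ m → 1 ≤ n → g₁ (m * n) = g₁ m * g₁ n)
    (hcm₂ : ∀ m n : ℕ, 1 ≤ m → 1 ≤ n → g₂ (m * n) = g₂ m * g₂ n)
    (hS₁ : ∀ n : ℕ, 1 ≤ n → ‖g₁ n‖ = 1) (hS₂ : ∀ n : ℕ, 1 ≤ n → ‖g₂ n‖ = 1)
    (hb₁ : ∀ n, ‖g₁ n‖ ≤ 1) (hb₂ : ∀ n, ‖g₂ n‖ ≤ 1)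
    {a : ℕ} (ha : 0 < a) {H : ℕ} (hH : 16 ≤ H) (haH : a ≤ H) {Pr : Finset ℕ}
    (hPr : ∀ p ∈ Pr, p.Prime ∧ ¬p ∣ a ∧ p ≤ H) (hne : Pr.Nonempty) (b h : ℤ) {x ω : ℝ}
    (hS : 0 < logWeightSum x ω) (hrange : (h.natAbs : ℝ) + 1 ≤ x / ω) :
    H * (∑ p ∈ Pr, 1 / (p : ℝ)) * ‖logAvg (corrInd a b h g₁ g₂) x ω‖ -
        a ^ 2 * (∑ p ∈ Pr, 1 / (p : ℝ)) - 2 * h.natAbs * Pr.card -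
        ((a : ℝ) ^ 2 + 2 * a * H + 2 * h.natAbs * H) * Pr.card *
          ((4 * H + 2 * Real.log H + 12) / logWeightSum x ω) ≤
      ‖logAvg (fun n => Trest a b h g₁ g₂ Pr H (a * n)) x ω‖ := by
  -- notation
  set σ : ℝ := ∑ p ∈ Pr, 1 / (p : ℝ) with hσ
  set S : ℝ := logWeightSum x ω with hSdef
  set L : ℝ := 4 * H + 2 * Real.log H + 12 with hL
  set X₀ := logAvg (corrInd a b h g₁ g₂) x ω with hX₀
  have hPr' : ∀ p ∈ Pr, p.Prime ∧ ¬p ∣ a := fun p hp => ⟨(hPr p hp).1, (hPr p hp).2.1⟩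
  have hH1 : 1 ≤ H := le_trans (by norm_num) hH
  have hHR : (16 : ℝ) ≤ H := by exact_mod_cast hH
  have hH0 : (0 : ℝ) < H := by linarith
  have haR : (1 : ℝ) ≤ a := by exact_mod_cast ha
  have haHR : (a : ℝ) ≤ H := by exact_mod_cast haH
  have hlogH : 0 ≤ Real.log H := Real.log_nonneg (by linarith)
  have hloga : Real.log a ≤ Real.log H := Real.log_le_log (by linarith) haHR
  have hL0 : 0 < L := by rw [hL]; positivity
  have hσ0 : 0 ≤ σ := sum_nonneg fun p _ => by positivity
  have hcard0 : (0 : ℝ) ≤ Pr.card := Nat.cast_nonneg _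
  have hhabs : (0 : ℝ) ≤ h.natAbs := Nat.cast_nonneg _
  -- the two error estimates
  have h1 := norm_logAvg_Tsum_mul_sub_le hcm₁ hcm₂ hS₁ hS₂ hb₁ hb₂ ha hPr' hne H hH1 b h hS hrange
    (x := x) (ω := ω)
  have h2 := norm_logAvg_restrict_sub_le hb₁ hb₂ hPr' H b h hS (x := x) (ω := ω)
  rw [← hSdef] at h1 h2
  rw [← hX₀] at h1
  -- per-prime simplifications
  have hp_facts : ∀ p ∈ Pr, (1 : ℝ) ≤ p ∧ (p : ℝ) ≤ H ∧ Real.log p ≤ Real.log H ∧ 0 ≤ Real.log p := by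
    intro p hp
    have h1p : (1 : ℝ) ≤ p := by exact_mod_cast (hPr p hp).1.one_lt.le
    have h2p : (p : ℝ) ≤ H := by exact_mod_cast (hPr p hp).2.2
    exact ⟨h1p, h2p, Real.log_le_log (by linarith) h2p, Real.log_nonneg h1p⟩
  have hE1term : ∀ p ∈ Pr,
      ((a : ℝ) - 1) / 2 * (4 * H / S + 2 * (1 / p + (8 + 2 * Real.log p) / S)) +
        H / a * ((8 + 2 * Real.log p) / S + 4 * ((H : ℝ) + 1) / (p * S)) ≤
      a * (1 / p) + ((a : ℝ) + H) * (L / S) := by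
    intro p hp
    obtain ⟨h1p, h2p, hlogp, hlogp0⟩ := hp_facts p hp
    have hp0 : (0 : ℝ) < p := by linarith
    -- `err_p ≤ L/S`
    have herr : (8 + 2 * Real.log p) / S + 4 * ((H : ℝ) + 1) / (p * S) ≤ L / S := by
      have e1 : 4 * ((H : ℝ) + 1) / (p * S) ≤ 4 * ((H : ℝ) + 1) / S := by
        rw [div_le_div_iff₀ (by positivity) hS]
        have : 0 ≤ 4 * ((H : ℝ) + 1) * S := by positivity
        nlinarith
      have e2 : (8 + 2 * Real.log p) / S + 4 * ((H : ℝ) + 1) / S = (8 + 2 * Real.log p + 4 * (H + 1)) / S := by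
        ring
      have e3 : (8 + 2 * Real.log p + 4 * ((H : ℝ) + 1)) / S ≤ L / S := by
        refine div_le_div_of_nonneg_right ?_ hS.le
        rw [hL]; linarith
      linarith
    -- `Δ_p ≤ 2/p + 2L/S`
    have hΔ : 4 * H / S + 2 * (1 / p + (8 + 2 * Real.log p) / S) ≤ 2 * (1 / p) + 2 * (L / S) := by
      have e1 : 4 * (H : ℝ) / S + 2 * ((8 + 2 * Real.log p) / S) = (4 * H + 16 + 4 * Real.log p) / S := by ring
      have e2 : (4 * (H : ℝ) + 16 + 4 * Real.log p) / S ≤ 2 * (L / S) := by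
        rw [← mul_div_assoc]
        refine div_le_div_of_nonneg_right ?_ hS.le
        rw [hL]; linarith
      linarith
    have ha1 : 0 ≤ ((a : ℝ) - 1) / 2 := by linarith
    have hLS : 0 ≤ L / S := by positivity
    have hp1 : 0 ≤ 1 / (p : ℝ) := by positivity
    calc ((a : ℝ) - 1) / 2 * (4 * H / S + 2 * (1 / p + (8 + 2 * Real.log p) / S)) +
          H / a * ((8 + 2 * Real.log p) / S + 4 * ((H : ℝ) + 1) / (p * S))
        ≤ ((a : ℝ) - 1) / 2 * (2 * (1 / p) + 2 * (L / S)) + H / a * (L / S) :=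
          add_le_add (mul_le_mul_of_nonneg_left hΔ ha1) (mul_le_mul_of_nonneg_left herr (by positivity))
      _ = ((a : ℝ) - 1) * (1 / p) + ((a : ℝ) - 1) * (L / S) + H / a * (L / S) := by ring
      _ ≤ a * (1 / p) + ((a : ℝ) + H) * (L / S) := by
          have hHa : (H : ℝ) / a ≤ H := div_le_self hH0.le haR
          nlinarith
  have hE1 : (a : ℝ) * ∑ p ∈ Pr, (((a : ℝ) - 1) / 2 * (4 * H / S + 2 * (1 / p + (8 + 2 * Real.log p) / S)) +
        H / a * ((8 + 2 * Real.log p) / S + 4 * ((H : ℝ) + 1) / (p * S))) +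
      a * (Pr.card * H) * ((8 + 2 * Real.log a) / S) ≤
      a ^ 2 * σ + ((a : ℝ) ^ 2 + 2 * a * H) * Pr.card * (L / S) := by
    have hsum : ∑ p ∈ Pr, (((a : ℝ) - 1) / 2 * (4 * H / S + 2 * (1 / p + (8 + 2 * Real.log p) / S)) +
        H / a * ((8 + 2 * Real.log p) / S + 4 * ((H : ℝ) + 1) / (p * S))) ≤
        a * σ + Pr.card * (((a : ℝ) + H) * (L / S)) := by
      calc _ ≤ ∑ p ∈ Pr, (a * (1 / (p : ℝ)) + ((a : ℝ) + H) * (L / S)) := sum_le_sum hE1term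
        _ = a * σ + Pr.card * (((a : ℝ) + H) * (L / S)) := by
            rw [sum_add_distrib, ← mul_sum, sum_const, nsmul_eq_mul]
    have hloga' : (8 + 2 * Real.log a) / S ≤ L / S := by
      refine div_le_div_of_nonneg_right ?_ hS.le
      rw [hL]; linarith
    have ha0 : (0 : ℝ) ≤ a := by linarith
    calc (a : ℝ) * ∑ p ∈ Pr, (((a : ℝ) - 1) / 2 * (4 * H / S + 2 * (1 / p + (8 + 2 * Real.log p) / S)) +
          H / a * ((8 + 2 * Real.log p) / S + 4 * ((H : ℝ) + 1) / (p * S))) +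
          a * (Pr.card * H) * ((8 + 2 * Real.log a) / S)
        ≤ a * (a * σ + Pr.card * (((a : ℝ) + H) * (L / S))) + a * (Pr.card * H) * (L / S) :=
          add_le_add (mul_le_mul_of_nonneg_left hsum ha0) (mul_le_mul_of_nonneg_left hloga' (by positivity))
      _ = a ^ 2 * σ + ((a : ℝ) ^ 2 + 2 * a * H) * Pr.card * (L / S) := by ring
  have hE2 : ∑ p ∈ Pr, 2 * ((p : ℝ) * h.natAbs) * (1 / p + (8 + 2 * Real.log p) / S) ≤
      2 * h.natAbs * Pr.card + 2 * h.natAbs * H * Pr.card * (L / S) := by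
    have hterm : ∀ p ∈ Pr, 2 * ((p : ℝ) * h.natAbs) * (1 / p + (8 + 2 * Real.log p) / S) ≤
        2 * h.natAbs + 2 * h.natAbs * H * (L / S) := by
      intro p hp
      obtain ⟨h1p, h2p, hlogp, hlogp0⟩ := hp_facts p hp
      have hp0 : (0 : ℝ) < p := by linarith
      have e1 : 2 * ((p : ℝ) * h.natAbs) * (1 / p + (8 + 2 * Real.log p) / S) =
          2 * h.natAbs + 2 * h.natAbs * (p * (8 + 2 * Real.log p)) / S := by
        field_simp
      rw [e1]
      have e2 : (p : ℝ) * (8 + 2 * Real.log p) ≤ H * L := by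
        rw [hL]
        have : (8 : ℝ) + 2 * Real.log p ≤ 4 * H + 2 * Real.log H + 12 := by linarith
        calc (p : ℝ) * (8 + 2 * Real.log p) ≤ H * (8 + 2 * Real.log p) :=
              mul_le_mul_of_nonneg_right h2p (by linarith)
          _ ≤ H * (4 * H + 2 * Real.log H + 12) := mul_le_mul_of_nonneg_left this hH0.le
      have e3 : 2 * (h.natAbs : ℝ) * (p * (8 + 2 * Real.log p)) / S ≤ 2 * h.natAbs * (H * L) / S := by
        refine div_le_div_of_nonneg_right ?_ hS.le
        exact mul_le_mul_of_nonneg_left e2 (by positivity)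
      have e4 : 2 * (h.natAbs : ℝ) * (H * L) / S = 2 * h.natAbs * H * (L / S) := by ring
      linarith
    calc _ ≤ ∑ p ∈ Pr, (2 * (h.natAbs : ℝ) + 2 * h.natAbs * H * (L / S)) := sum_le_sum hterm
      _ = 2 * h.natAbs * Pr.card + 2 * h.natAbs * H * Pr.card * (L / S) := by
          rw [sum_const, nsmul_eq_mul]; ring
  -- the main term
  have hmain : ‖(H : ℂ) * (∑ p ∈ Pr, 1 / (p : ℂ)) * X₀‖ = H * σ * ‖X₀‖ := by
    have e : (∑ p ∈ Pr, 1 / (p : ℂ)) = ((σ : ℝ) : ℂ) := by rw [hσ]; push_cast; rfl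
    rw [e, norm_mul, norm_mul, Complex.norm_natCast, Complex.norm_real, Real.norm_of_nonneg hσ0]
  -- reverse triangle inequality
  have key : H * σ * ‖X₀‖ ≤ ‖logAvg (fun n => Trest a b h g₁ g₂ Pr H (a * n)) x ω‖ +
      (a ^ 2 * σ + ((a : ℝ) ^ 2 + 2 * a * H) * Pr.card * (L / S)) +
      (2 * h.natAbs * Pr.card + 2 * h.natAbs * H * Pr.card * (L / S)) := by
    rw [← hmain]
    have t1 := norm_sub_le_norm_sub_add_norm_sub ((H : ℂ) * (∑ p ∈ Pr, 1 / (p : ℂ)) * X₀)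
      (logAvg (fun n => Tsum a b h g₁ g₂ Pr H (a * n)) x ω)
      (logAvg (fun n => Trest a b h g₁ g₂ Pr H (a * n)) x ω)
    rw [norm_sub_rev] at h1
    have t2 : ‖(H : ℂ) * (∑ p ∈ Pr, 1 / (p : ℂ)) * X₀‖ ≤
        ‖logAvg (fun n => Trest a b h g₁ g₂ Pr H (a * n)) x ω‖ +
          ‖(H : ℂ) * (∑ p ∈ Pr, 1 / (p : ℂ)) * X₀ - logAvg (fun n => Trest a b h g₁ g₂ Pr H (a * n)) x ω‖ := by
      have := norm_add_le (logAvg (fun n => Trest a b h g₁ g₂ Pr H (a * n)) x ω)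
        ((H : ℂ) * (∑ p ∈ Pr, 1 / (p : ℂ)) * X₀ - logAvg (fun n => Trest a b h g₁ g₂ Pr H (a * n)) x ω)
      rwa [add_sub_cancel] at this
    linarith [h1.trans hE1, h2.trans hE2]
  have e5 : ((a : ℝ) ^ 2 + 2 * a * H + 2 * h.natAbs * H) * Pr.card * (L / S) =
      ((a : ℝ) ^ 2 + 2 * a * H) * Pr.card * (L / S) + 2 * h.natAbs * H * Pr.card * (L / S) := by ring
  rw [e5]
  linarith

end Tao2016

end Literature.NumberTheory.LFunctions
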